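import Summits.QuantumFields.YangMills.Theorems.IR.EsPolymerTorusCells
import Summits.QuantumFields.YangMills.Theorems.IR.BlockedActivityCalibrationCells

/-!
# Crux `IR` (item stmt-QuantumFields-19354) — line «es-polymer-decoupling», engine `stub_polymerEngineK`:
# CELLS OF A GENERAL PERIODIC GRID read through the periodic lift (the species ↦ block bookkeeping, input (d))

Helper module for item `stmt-QuantumFields-19354` (`--supports … --as helper`; it closes nothing; lead prover
ym-ir-line-mxc-p1 g3, director-ym R366 pooled task «es-polymer engine»).  Input (d) of the open, PROVABLE engine stub
`EsPolymer.stub_polymerEngineK : PolymerEngineK` (`Theorems/IR/EsPolymerDefsK.lean`): on the torus of side `N` with a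
periodic grid `w` of mesh `b ≥ 1` and `q` cells per direction (`IsGrid N b q w` of `Theorems/IR/EsPolymerDefs.lean`),

* §1 frame-index arithmetic (`frameIdx` of `Theorems/BalabanLadderIRFrameCells.lean`, monotonicity from
  `Theorems/IR/BlockedActivityCalibrationCells.lean`): the cell index is `1`-Lipschitz
  (`natAbs_frameIdx_sub_le`), `q`-periodic under the period `N` (`frameIdx_add_mul`), `0` at `0`, in `[0, q)` on `[0, N)`,
  and `w j ≤ 2 b j`;
* §2 `gridCell q w x : Cell q` — the cell of the cell-torus containing the site `x ∈ ℤ⁴`; every torus edge based at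
  `x mod N` is an edge of that cell (`torusEdge_mem_torusCellEdges_gridCell`); cells of sites at sup-distance `≤ M` are at
  cell distance `≤ M` (`cellDist_gridCell_le`); and the cell of `n e₀`, `n ≤ S`, `N = 2S+1`, is at cell distance `d` from the
  cell of the origin with `n < 2b (d + 1)` (`lt_two_mul_mul_cellDist_gridCell_succ`);
* §3 a local gauge-invariant observable `A` read through `torusLift N` depends only on the links of the block of cell-radius
  `suppRadius A` about the cell of the origin, and `B` translated by `v` depends only on the block about the cell of `v`
  (`dependsOn_torusLift_blockEdges`, `dependsOn_configShift_torusLift_blockEdges`).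

Pure lattice bookkeeping; no measure theory beyond `DependsOn`.  HONEST FRAMING: bookkeeping toward ONE provable stub of a
CONDITIONAL rung line; the line's load `IRPolymerCertK` (XL) is untouched; nothing here bears on the Clay YM mass gap;
R4 closes only the conditional finite-𝕋⁴ rung `BalabanLadder.UV`.
-/

set_option autoImplicit false

noncomputable section

open MeasureTheory Finset Function
open Literature.MathematicalPhysics.QuantumFieldTheory Literature.MathematicalPhysics.QuantumLattice
open Literature.Probability.LatticeModels (Torus.proj)
open Summit.QuantumFields.YangMills.Cruxes.IR.Tempered (cellEdges)
open Summit.QuantumFields.YangMills.Cruxes.IR.CellTempered.Engine (frameIdx frameIdx_le lt_frameIdx_succ frameIdx_eq_iff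
  frame_add_nat_le)
open Summit.QuantumFields.YangMills.Cruxes.IR.BlockedActivity (frameIdx_mono frameSeq_mono)

namespace Summit.QuantumFields.YangMills.Cruxes.IR.EsPolymer

/-! ## §1 Frame-index arithmetic -/

section FrameGrowth

variable {f : ℤ → ℤ}

/-- Upper growth: `f (j + m) ≤ f j + 2 b m` when the increments are `≤ 2 b`. -/
theorem frame_add_nat_le_two_mul {b : ℕ} (hf2 : ∀ j, f (j + 1) ≤ f j + 2 * (b : ℤ)) (j : ℤ) (m : ℕ) :
    f (j + m) ≤ f j + 2 * (b : ℤ) * m := by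
  induction m with
  | zero => simp
  | succ m ih =>
    have h1 := hf2 (j + m)
    push_cast
    rw [← add_assoc]
    linarith

/-- Periodicity: `f (j + q m) = f j + N m` for all integers `m` when `f (j + q) = f j + N`. -/
theorem frame_add_mul {q N : ℕ} (hper : ∀ j, f (j + q) = f j + N) (j m : ℤ) :
    f (j + (q : ℤ) * m) = f j + (N : ℤ) * m := by
  induction m using Int.induction_on generalizing j with
  | zero => simp
  | succ m ih =>
    have h := hper (j + (q : ℤ) * m)
    rw [ih] at h
    rw [mul_add, mul_one, ← add_assoc, h]
    ring
  | pred m ih =>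
    have h := hper (j + (q : ℤ) * (-(m : ℤ) - 1))
    have e : j + (q : ℤ) * (-(m : ℤ) - 1) + (q : ℤ) = j + (q : ℤ) * (-(m : ℤ)) := by ring
    rw [e, ih] at h
    linarith

end FrameGrowth

section FrameIdx

variable {f : ℤ → ℤ} (hf : ∀ j, f j + 1 ≤ f (j + 1))
include hf

/-- One-sided Lipschitz bound: `frameIdx f t ≤ frameIdx f s + (t - s)⁺`. -/
theorem frameIdx_le_add_toNat (s t : ℤ) : frameIdx f t ≤ frameIdx f s + ((t - s).toNat : ℤ) := by
  rcases le_or_gt t s with hts | hst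
  · have h0 : ((t - s).toNat : ℤ) = 0 := by rw [Int.toNat_eq_zero.mpr (by linarith)]; rfl
    rw [h0, add_zero]
    exact frameIdx_mono hf hts
  · have hm : ((t - s).toNat : ℤ) = t - s := Int.toNat_of_nonneg (by linarith)
    by_contra h
    push Not at h
    -- `f (frameIdx f s + 1 + m) ≥ f (frameIdx f s + 1) + m > s + m = t`
    have h1 := frame_add_nat_le hf (frameIdx f s + 1) (t - s).toNat
    have h2 : f (frameIdx f s + 1 + ((t - s).toNat : ℤ)) ≤ f (frameIdx f t) := frameSeq_mono hf (by omega)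
    linarith [frameIdx_le hf t, lt_frameIdx_succ hf s]

/-- **The frame index is `1`-Lipschitz** (cells have width `≥ 1`). -/
theorem natAbs_frameIdx_sub_le (s t : ℤ) : (frameIdx f s - frameIdx f t).natAbs ≤ (s - t).natAbs := by
  have h1 := frameIdx_le_add_toNat hf s t
  have h2 := frameIdx_le_add_toNat hf t s
  have e1 : ((t - s).toNat : ℤ) ≤ |s - t| := by
    have h : (t - s).toNat ≤ (t - s).natAbs := Int.toNat_le.mpr Int.le_natAbs
    have h' : ((t - s).toNat : ℤ) ≤ ((t - s).natAbs : ℤ) := by exact_mod_cast h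
    rw [Int.natCast_natAbs, abs_sub_comm] at h'
    exact h'
  have e2 : ((s - t).toNat : ℤ) ≤ |s - t| := by
    have h : (s - t).toNat ≤ (s - t).natAbs := Int.toNat_le.mpr Int.le_natAbs
    have h' : ((s - t).toNat : ℤ) ≤ ((s - t).natAbs : ℤ) := by exact_mod_cast h
    rw [Int.natCast_natAbs] at h'
    exact h'
  rw [← Int.ofNat_le, Int.natCast_natAbs, Int.natCast_natAbs, abs_le]
  constructor <;> linarith

/-- The frame index of `0` is `0` when `f 0 = 0`. -/
theorem frameIdx_zero (h0 : f 0 = 0) : frameIdx f 0 = 0 := by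
  rw [frameIdx_eq_iff hf]
  have h1 := hf 0
  simp only [zero_add] at h1 ⊢
  exact ⟨h0.le, by linarith⟩

/-- **Periodicity of the frame index**: `frameIdx f (t + N m) = frameIdx f t + q m`. -/
theorem frameIdx_add_mul {q N : ℕ} (hper : ∀ j, f (j + q) = f j + N) (t m : ℤ) :
    frameIdx f (t + (N : ℤ) * m) = frameIdx f t + (q : ℤ) * m := by
  rw [frameIdx_eq_iff hf]
  refine ⟨?_, ?_⟩
  · rw [frame_add_mul hper]
    linarith [frameIdx_le hf t]
  · have e : frameIdx f t + (q : ℤ) * m + 1 = (frameIdx f t + 1) + (q : ℤ) * m := by ring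
    rw [e, frame_add_mul hper]
    linarith [lt_frameIdx_succ hf t]

/-- On `[0, N)` the frame index lies in `[0, q)` (for `f 0 = 0`, `f q = N`). -/
theorem frameIdx_nonneg_lt {q N : ℕ} (h0 : f 0 = 0) (hper : ∀ j, f (j + q) = f j + N) {t : ℤ} (ht0 : 0 ≤ t)
    (htN : t < N) : 0 ≤ frameIdx f t ∧ frameIdx f t < q := by
  refine ⟨?_, ?_⟩
  · rw [← frameIdx_zero hf h0]
    exact frameIdx_mono hf ht0
  · by_contra h
    push Not at h
    have hq : f q = N := by have := hper 0; rw [zero_add, h0, zero_add] at this; exact this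
    have h1 : f q ≤ f (frameIdx f t) := frameSeq_mono hf h
    linarith [frameIdx_le hf t]

end FrameIdx

/-! ## §2 The cell of a lattice site in a periodic grid -/

section GridCell

variable {q : ℕ} [NeZero q]

/-- **The cell of the site `x ∈ ℤ⁴`** in the periodic grid `w` with `q` cells per direction: coordinatewise the frame index
of `x i`, read modulo `q` (a cell of the cell-torus `Cell q`). -/
def gridCell (q : ℕ) [NeZero q] (w : Fin 4 → ℤ → ℤ) (x : Fin 4 → ℤ) : Cell q :=
  cellEquiv.symm fun i => ((frameIdx (w i) (x i) : ℤ) : ZMod q)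

/-- The torus site of `gridCell q w x` is `(frameIdx (w i) (x i) mod q)_i`. -/
theorem cellEquiv_gridCell (w : Fin 4 → ℤ → ℤ) (x : Fin 4 → ℤ) (i : Fin 4) :
    cellEquiv (gridCell q w x) i = ((frameIdx (w i) (x i) : ℤ) : ZMod q) := by
  simp [gridCell]

omit [NeZero q] in
/-- Cells of width `≥ 1` from a grid of mesh `b ≥ 1`. -/
theorem width_one_of_isGrid {N b : ℕ} {w : Fin 4 → ℤ → ℤ} (hG : IsGrid N b q w) (hb : 1 ≤ b) :
    ∀ i j, w i j + 1 ≤ w i (j + 1) := fun i j => by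
  have h := (hG.2.2.1 i j).1
  have hb' : (1 : ℤ) ≤ (b : ℤ) := by exact_mod_cast hb
  linarith

/-- **Every torus edge based at `x mod N` is an edge of the cell `gridCell q w x`.** -/
theorem torusEdge_mem_torusCellEdges_gridCell {N b : ℕ} {w : Fin 4 → ℤ → ℤ} (hG : IsGrid N b q w) (hb : 1 ≤ b)
    (x : Fin 4 → ℤ) (i : Fin 4) : torusEdge N (x, i) ∈ torusCellEdges N q w (gridCell q w x) := by
  classical
  have hw1 := width_one_of_isGrid hG hb
  have hper := hG.2.2.2
  set c : Cell q := gridCell q w x with hc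
  -- the fundamental cell index `jj k ∈ [0, q)` is congruent to the frame index `J k` modulo `q`
  have hcong : ∀ k, ∃ m : ℤ, frameIdx (w k) (x k) = ((c k).val : ℤ) + (q : ℤ) * m := fun k => by
    have h1 : (((c k).val : ℤ) : ZMod q) = ((frameIdx (w k) (x k) : ℤ) : ZMod q) := by
      rw [Int.cast_natCast, natCast_val_eq_cellEquiv, hc, cellEquiv_gridCell]
    obtain ⟨m, hm⟩ := (ZMod.intCast_eq_intCast_iff_dvd_sub _ _ _).1 h1
    exact ⟨m, by linarith⟩
  choose m hm using hcong
  set x' : Fin 4 → ℤ := fun k => x k - (N : ℤ) * m k with hx'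
  rw [torusCellEdges, Finset.mem_image]
  refine ⟨(x', i), ?_, ?_⟩
  · simp only [Summit.QuantumFields.YangMills.Cruxes.IR.Tempered.cellEdges, Finset.mem_product, Finset.mem_univ,
      and_true, Fintype.mem_piFinset, Finset.mem_Ico]
    intro k
    have hJ : ((c k).val : ℤ) = frameIdx (w k) (x k) + (q : ℤ) * (-(m k)) := by linarith [hm k]
    constructor
    · rw [hJ, frame_add_mul (hper k)]
      have := frameIdx_le (hw1 k) (x k)
      simp only [hx']; linarith
    · have e : ((c k).val : ℤ) + 1 = (frameIdx (w k) (x k) + 1) + (q : ℤ) * (-(m k)) := by linarith [hm k]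
      rw [e, frame_add_mul (hper k)]
      have := lt_frameIdx_succ (hw1 k) (x k)
      simp only [hx']; linarith
  · simp only [torusEdge, Prod.mk.injEq, and_true]
    funext k
    simp [Torus.proj, hx']

/-- **Cells of nearby sites are nearby**: if `|x k − y k| ≤ M` for all `k` then the cells are at cell distance `≤ M`. -/
theorem cellDist_gridCell_le {w : Fin 4 → ℤ → ℤ} (hw1 : ∀ i j, w i j + 1 ≤ w i (j + 1)) (x y : Fin 4 → ℤ) {M : ℕ}
    (hM : ∀ k, (x k - y k).natAbs ≤ M) : cellDist (gridCell q w x) (gridCell q w y) ≤ M := by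
  rw [cellDist_eq_torusNorm]
  refine Finset.sup_le fun k _ => ?_
  have h : (cellEquiv (gridCell q w x) - cellEquiv (gridCell q w y)) k =
      (((frameIdx (w k) (x k) - frameIdx (w k) (y k) : ℤ)) : ZMod q) := by
    rw [Pi.sub_apply, cellEquiv_gridCell, cellEquiv_gridCell, Int.cast_sub]
  rw [h]
  exact (Literature.MathematicalPhysics.QuantumFieldTheory.natAbs_valMinAbs_intCast_le q _).trans ((natAbs_frameIdx_sub_le (hw1 k) _ _).trans (hM k))

/-- The cell of the origin is the torus site `0`. -/
theorem cellEquiv_gridCell_zero {N b : ℕ} {w : Fin 4 → ℤ → ℤ} (hG : IsGrid N b q w) (hb : 1 ≤ b) :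
    cellEquiv (gridCell q w 0) = 0 := by
  funext i
  rw [cellEquiv_gridCell, Pi.zero_apply, frameIdx_zero (width_one_of_isGrid hG hb i) (hG.2.1 i), Int.cast_zero,
    Pi.zero_apply]

/-- **The time translation in cells.**  On the torus of side `2S+1`, for `n ≤ S`, the cell of `n e₀` is at cell distance `d`
from the cell of the origin with `n < 2b (d + 1)`: going either way round the cell-torus one crosses at least `n / (2b) − 1`
cells of width `≤ 2b` (no wrap-around below half the period). -/
theorem lt_two_mul_mul_cellDist_gridCell_succ {S b : ℕ} {w : Fin 4 → ℤ → ℤ} (hG : IsGrid (2 * S + 1) b q w) (hb : 1 ≤ b)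
    {n : ℕ} (hn : n ≤ S) :
    n < 2 * b * (cellDist (gridCell q w 0) (gridCell q w (Pi.single 0 (n : ℤ))) + 1) := by
  have hw1 := width_one_of_isGrid hG hb
  have h0 := hG.2.1 (0 : Fin 4)
  have hper := hG.2.2.2 (0 : Fin 4)
  have hf2 : ∀ j, w 0 (j + 1) ≤ w 0 j + 2 * (b : ℤ) := fun j => (hG.2.2.1 0 j).2
  set J : ℤ := frameIdx (w 0) n with hJ
  obtain ⟨hJ0, hJq⟩ := frameIdx_nonneg_lt (hw1 0) h0 hper (t := (n : ℤ)) (by positivity) (by push_cast; omega)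
  have hwJ : w 0 J ≤ n := frameIdx_le (hw1 0) n
  have hwJ1 : (n : ℤ) < w 0 (J + 1) := lt_frameIdx_succ (hw1 0) n
  -- (i) `n < 2b (J + 1)`
  have hi : (n : ℤ) < 2 * (b : ℤ) * (J + 1) := by
    have h := frame_add_nat_le_two_mul hf2 0 (J + 1).toNat
    rw [zero_add, h0, zero_add, Int.toNat_of_nonneg (by omega)] at h
    linarith
  -- (ii) `n < 2b (q - J)`
  have hii : (n : ℤ) < 2 * (b : ℤ) * ((q : ℤ) - J) := by
    have h := frame_add_nat_le_two_mul hf2 J ((q : ℤ) - J).toNat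
    rw [Int.toNat_of_nonneg (by omega), add_sub_cancel] at h
    have hq : w 0 q = 2 * S + 1 := by have := hper 0; rw [zero_add, h0, zero_add] at this; exact_mod_cast this
    have hnS : (n : ℤ) ≤ S := by exact_mod_cast hn
    linarith
  -- the coordinate-0 cyclic distance `d₀ = min J (q - J)` bounds `cellDist` from below
  set Jn : ℕ := J.toNat with hJn
  have hJJn : (J : ℤ) = Jn := (Int.toNat_of_nonneg hJ0).symm
  have hJnq : Jn < q := by omega
  have hd0 : min Jn (q - Jn) ≤ cellDist (gridCell q w 0) (gridCell q w (Pi.single 0 (n : ℤ))) := by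
    rw [cellDist_eq_torusNorm, cellEquiv_gridCell_zero hG hb, zero_sub, torusNorm_neg]
    refine le_trans ?_ (natAbs_valMinAbs_le_torusNorm _ 0)
    rw [cellEquiv_gridCell, Pi.single_eq_same, ← hJ, hJJn, Int.cast_natCast, ZMod.valMinAbs_natAbs_eq_min,
      ZMod.val_natCast_of_lt hJnq]
  have hmin : (n : ℤ) < 2 * (b : ℤ) * ((min Jn (q - Jn) : ℕ) + 1) := by
    rcases min_choice Jn (q - Jn) with h | h <;> rw [h]
    · rw [← hJJn]; exact hi
    · rw [Nat.cast_sub hJnq.le, ← hJJn]; linarith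
  have hfin : (n : ℤ) < 2 * (b : ℤ) * ((cellDist (gridCell q w 0) (gridCell q w (Pi.single 0 (n : ℤ))) : ℤ) + 1) := by
    have : ((min Jn (q - Jn) : ℕ) : ℤ) ≤ cellDist (gridCell q w 0) (gridCell q w (Pi.single 0 (n : ℤ))) := by
      exact_mod_cast hd0
    nlinarith
  exact_mod_cast hfin

end GridCell

/-! ## §3 Supports of local observables read through the periodic lift, in cells -/

section Supports

variable {G : Type} [Group G] [MeasurableSpace G] {q : ℕ} [NeZero q]

/-- The sup-norm radius of the edge support of a local observable (max over the support of the base coordinates). -/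
def suppRadius (A : LocalGaugeObservable 4 G) : ℕ := A.supp.sup fun e => Finset.univ.sup fun k => (e.1 k).natAbs

omit [NeZero q] in
/-- Base coordinates of support edges are bounded by `suppRadius`. -/
theorem natAbs_le_suppRadius (A : LocalGaugeObservable 4 G) {e : Literature.MathematicalPhysics.QuantumLattice.ZdEdge 4}
    (he : e ∈ A.supp) (k : Fin 4) : (e.1 k).natAbs ≤ suppRadius A :=
  (Finset.le_sup (f := fun k => (e.1 k).natAbs) (Finset.mem_univ k)).trans
    (Finset.le_sup (f := fun e : Literature.MathematicalPhysics.QuantumLattice.ZdEdge 4 =>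
      Finset.univ.sup fun k => (e.1 k).natAbs) he)

omit [Group G] [MeasurableSpace G] [NeZero q] in
/-- Blocks grow with the radius. -/
theorem blockEdges_mono {N : ℕ} (w : Fin 4 → ℤ → ℤ) (c : Cell q) {R R' : ℕ} (h : R ≤ R') :
    blockEdges N q w c R ⊆ blockEdges N q w c R' := fun _ ⟨c', hc', he⟩ => ⟨c', hc'.trans h, he⟩

/-- **A translated local observable read through the periodic lift depends only on the links of the block of cell-radius
`suppRadius B` about the cell of the translation vector.** -/
theorem dependsOn_configShift_torusLift_blockEdges {N b : ℕ} {w : Fin 4 → ℤ → ℤ} (hG : IsGrid N b q w) (hb : 1 ≤ b)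
    (B : LocalGaugeObservable 4 G) (v : Fin 4 → ℤ) :
    DependsOn (fun U : GaugeConfig 4 N G => B.F (configShift (-v) (torusLift N U)))
      (blockEdges N q w (gridCell q w v) (suppRadius B)) := by
  intro U V hUV
  apply B.isCylinder
  intro e he
  rw [configShift_apply, configShift_apply]
  show U (torusEdge N (e.1 - -v, e.2)) = V (torusEdge N (e.1 - -v, e.2))
  refine hUV (torusEdge N (e.1 - -v, e.2)) ⟨gridCell q w (e.1 - -v), ?_, ?_⟩
  · rw [show cellDist (gridCell q w v) (gridCell q w (e.1 - -v)) = cellDist (gridCell q w (e.1 - -v)) (gridCell q w v) by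
      rw [cellDist_eq_torusNorm, cellDist_eq_torusNorm, ← torusNorm_neg, neg_sub]]
    refine cellDist_gridCell_le (width_one_of_isGrid hG hb) _ _ fun k => ?_
    simp only [Pi.sub_apply, Pi.neg_apply, sub_neg_eq_add, add_sub_cancel_right]
    exact natAbs_le_suppRadius B (Finset.mem_coe.1 he) k
  · exact torusEdge_mem_torusCellEdges_gridCell hG hb _ _

/-- **A local observable read through the periodic lift depends only on the links of the block of cell-radius `suppRadius A`
about the cell of the origin.** -/
theorem dependsOn_torusLift_blockEdges {N b : ℕ} {w : Fin 4 → ℤ → ℤ} (hG : IsGrid N b q w) (hb : 1 ≤ b)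
    (A : LocalGaugeObservable 4 G) :
    DependsOn (fun U : GaugeConfig 4 N G => A.F (torusLift N U)) (blockEdges N q w (gridCell q w 0) (suppRadius A)) := by
  have h := dependsOn_configShift_torusLift_blockEdges hG hb A 0
  have h0 : ∀ W : GaugeConfig 4 N G, configShift (-(0 : Fin 4 → ℤ)) (torusLift N W) = torusLift N W := fun W => by
    funext e
    rw [configShift_apply, neg_zero, sub_zero]
  intro U V hUV
  have key := h hUV
  simp only [h0] at key
  exact key

end Supports

end Summit.QuantumFields.YangMills.Cruxes.IR.EsPolymer

end
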